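import Literature.Geometry.Symplectic.OrigamiNullFoliation
import Literature.Geometry.Manifold.FreeCircleQuotientProjection
import HarnessLib

/-!
# The null fibration `Z → B` of an origami form: the base `B = Z/S¹` is a compact surface

Third proofs companion of `OrigamiUnfolding.lean` (fact seat of
`Literature.Geometry.Symplectic.exists_symplecticCutPieces_of_isOrigamiForm`; architecture in
`OrigamiUnfoldingProofs.lean`). Cannas da Silva–Guillemin–Pires, *Symplectic Origami*
(arXiv:0909.4065), Def. 2.2 (p. 5 of the arXiv text): an origami form is a folded form "whose
null foliation integrates to a principal `S¹`-fibration, called the null fibration, over a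
compact base `B`", `S¹ ↪ Z ↠ B`; after Def. 2.5: "The null foliation `V` is the vertical bundle
of `π`". In the tree's rendering `IsOrigamiForm s` the circle action `θ` on the folding
hypersurface `j : N ↪ M` is DATA (free, smooth, orbits tangent to `ker ω`), and the base is not
mentioned. This file produces it: by the quotient manifold theorem for free smooth circle actions
(`Literature.Geometry.Manifold.isManifold_circleQuotient`, `contMDiff_circleQuotientMk`,
`surjective_mfderiv_circleQuotientMk` — Lee 2012, Thm. 21.10 with `G = S¹`, proved in
`Literature/Geometry/Manifold/FreeCircleQuotient*.lean`) the orbit space `B = N/S¹` is a compact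
Hausdorff `C^∞` surface, connected when the fold is, and `π : N → B` is a `C^∞` submersion and
open quotient map with the orbits as fibres and `ker dπ` the orbit line (= the null line
`TZ ∩ ker ω`, `IsFoldedForm.altKer_inf_span_range_eq_span` of `OrigamiNullFoliation.lean`):
`IsOrigamiForm.exists_nullFibration`. The surfaces `S i` of the fact's conclusion are two copies
of this `B` (Prop. 2.8: "`B` embeds as a symplectic submanifold … `M` is recovered from `M₀` by
blowing up `M₀` along the two copies of `B`").

Everything here is proved; no definitions, no facts.

## References

* A. Cannas da Silva, V. Guillemin, A. R. Pires, *Symplectic Origami*, IMRN 2011 =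
  arXiv:0909.4065, Def. 2.2, Def. 2.5 ff., Prop. 2.8. [CannasdasilvaGuilleminPires2010]
* J. M. Lee, *Introduction to Smooth Manifolds*, 2nd ed. (2012), Thm. 21.10.
  [LeeSmoothManifolds2013]
-/

noncomputable section

open scoped Manifold ContDiff Topology
open Set Function Module TopologicalSpace Topology
open Literature.Geometry.Kaehler Literature.Geometry.Manifold

namespace Literature.Geometry.Symplectic

variable {M : Type*} [TopologicalSpace M] [T2Space M] [ChartedSpace (EuclideanSpace ℝ (Fin 4)) M]

/-- `dim ℝ² + 1 = 3`. [folklore] -/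
private theorem finrank_two_add_one :
    Module.finrank ℝ (EuclideanSpace ℝ (Fin 2)) + 1 = 3 := by
  simp [finrank_euclideanSpace]

/-- **The null fibration of an origami form** (Def. 2.2: a folded form is origami when its "null
foliation integrates to a principal `S¹`-fibration … over a compact base `B`", `π : Z ↠ B`;
after Def. 2.5: "The null foliation `V` is the vertical bundle of `π`"). For the tree's
`IsOrigamiForm s` — fold data `(N, j, θ)`: a compact folding hypersurface `j : N ↪ M` with a free
smooth circle action `θ` whose orbits are tangent to `ker ω` — the orbit space `B = N/S¹` of the
action is, by the quotient manifold theorem for free circle actions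
(`Literature.Geometry.Manifold.isManifold_circleQuotient`, Lee 2012, Thm. 21.10), a compact
Hausdorff `C^∞` surface (modelled on `ℝ²`), connected when the fold is, and the orbit map
`π : N → B` is a `C^∞` submersion and an open quotient map whose fibres are the orbits and whose
kernel `ker dπ_n` is the line spanned by the orbit velocity, i.e. the null line `T Z ∩ ker ω`
(`IsFoldedForm.altKer_inf_span_range_eq_span`). This is the base `B` and bundle `Z → B` entering
steps (S1)–(S2) of the unfolding (Prop. 2.8). [cite: CannasdasilvaGuilleminPires2010, Def. 2.2] -/
theorem IsOrigamiForm.exists_nullFibration {s : MForm (𝓡 4) M ℝ 2} (hs : IsOrigamiForm s) :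
    ∃ (N : Type) (_ : TopologicalSpace N) (_ : T2Space N) (_ : CompactSpace N)
      (_ : ChartedSpace (EuclideanSpace ℝ (Fin 3)) N) (_ : IsManifold (𝓡 3) ∞ N) (j : N → M)
      (_ : MulAction Circle N)
      (B : Type) (_ : TopologicalSpace B) (_ : T2Space B) (_ : CompactSpace B)
      (_ : ChartedSpace (EuclideanSpace ℝ (Fin 2)) B) (_ : IsManifold (𝓡 2) ∞ B) (π : N → B),
      IsFoldedForm s N j ∧
      ContMDiff ((𝓡 1).prod (𝓡 3)) (𝓡 3) ∞ (fun p : Circle × N => p.1 • p.2) ∧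
      (∀ (a : Circle) (n : N), a • n = n → a = 1) ∧
      (∀ (n : N) (w : TangentSpace (𝓡 4) (j n)),
        s (j n) ![mfderiv 𝓘(ℝ, ℝ) (𝓡 4) (fun t : ℝ => j (Circle.exp t • n)) 0 (1 : ℝ), w] = 0) ∧
      IsOpenQuotientMap π ∧ (∀ n n' : N, π n = π n' ↔ ∃ a : Circle, a • n' = n) ∧
      ContMDiff (𝓡 3) (𝓡 2) ∞ π ∧ (∀ n, Surjective (mfderiv (𝓡 3) (𝓡 2) π n)) ∧
      (∀ n, mfderiv (𝓡 3) (𝓡 2) π n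
        (mfderiv 𝓘(ℝ, ℝ) (𝓡 3) (fun t : ℝ => Circle.exp t • n) 0 (1 : ℝ)) = 0) ∧
      (∀ n, Module.finrank ℝ
        (LinearMap.ker (mfderiv (𝓡 3) (𝓡 2) π n).toLinearMap) = 1) ∧
      (IsConnected (fold s) → ConnectedSpace N ∧ ConnectedSpace B) := by
  obtain ⟨N, _, _, _, _, j, θ, hf, hθ, h1, hmul, hfree, htan⟩ := hs.exists_fold
  letI : MulAction Circle N := circleMulAction θ h1 hmul
  haveI : T2Space N := hf.embedding.isEmbedding.t2Space
  have hθ' : ContMDiff ((𝓡 1).prod (𝓡 3)) (𝓡 3) ∞ (fun p : Circle × N => p.1 • p.2) := hθ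
  have hfree' : ∀ (a : Circle) (n : N), a • n = n → a = 1 := hfree
  haveI : ContinuousSMul Circle N := ⟨hθ'.continuous⟩
  letI := circleQuotientChartedSpace (EuclideanSpace ℝ (Fin 2)) hθ' hfree' finrank_two_add_one
  haveI := isManifold_circleQuotient (F := EuclideanSpace ℝ (Fin 2)) hθ' hfree'
    finrank_two_add_one
  refine ⟨N, inferInstance, inferInstance, inferInstance, inferInstance, inferInstance, j,
    inferInstance, CircleQuotient N, inferInstance, inferInstance, inferInstance, inferInstance,
    inferInstance, circleQuotientMk, hf, hθ', hfree', htan,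
    isOpenQuotientMap_circleQuotientMk, fun n n' => circleQuotientMk_eq_iff,
    contMDiff_circleQuotientMk hθ' hfree' finrank_two_add_one,
    surjective_mfderiv_circleQuotientMk hθ' hfree' finrank_two_add_one,
    mfderiv_circleQuotientMk_apply_orbit hθ' hfree' finrank_two_add_one,
    finrank_ker_mfderiv_circleQuotientMk hθ' hfree' finrank_two_add_one, fun hZ => ?_⟩
  -- connectedness: `N ≃ fold s` through the embedding `j`
  have hN : ConnectedSpace N := by
    rw [connectedSpace_iff_univ]
    refine ⟨?_, ?_⟩
    · obtain ⟨x, hx⟩ := hZ.nonempty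
      rw [← hf.range_eq] at hx
      obtain ⟨n, rfl⟩ := hx
      exact ⟨n, mem_univ n⟩
    · apply (hf.embedding.isEmbedding.isInducing.isPreconnected_image (s := univ)).1
      rw [image_univ, hf.range_eq]
      exact hZ.isPreconnected
  exact ⟨hN, connectedSpace_circleQuotient⟩

end Literature.Geometry.Symplectic

end
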